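import Literature.Topology.FourManifolds.KhTriangle
import HarnessLib

/-!
# The third Reidemeister move: the abstract local model of the triangle and the transfer of
# state circles between the two sides

Sibling file of `KhComplex.lean`, continuing `KhTriangle.lean`. The gluings of a state of `G`
and of its braid rearrangement `G.braidMove x y z` differ only at the six local passages, where
they are given by the twelve tables of `KhTriangle.lean` on the nine local arcs. This file makes
that finite bookkeeping computable:

* `LocArc` — the nine **abstract local arcs** (`inA, outA, inB, outB, inC, outC` and the sides
  `sA, sB, sC`), interpreted in `G` by `locArc`; `locEdgesG bx by bz` / `locEdgesG' bx by bz` —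
  the local gluings of `G` / `G.braidMove x y z` over a state with `(σ x, σ y, σ z) = (bx, by, bz)`
  as lists of pairs of abstract arcs, and `locGraph` the finite graph they span;
* `glueRel_local` / `glueRel_braidMove_local` — every gluing of `G` / `G.braidMove x y z` at a
  local passage is (the interpretation of) a listed pair, and `reachable_locArc_of_mem` /
  `reachable_braidMove_locArc_of_mem` — every listed pair is glued;
* `reachable_transfer` — **the transfer principle**: given a retouching `pl` of the sides into
  ends such that every listed pair of one side becomes connected in the local graph of the other
  (a decidable, finite check), reachability in a state graph of one side implies reachability
  of the retouched arcs in the corresponding state graph of the other side.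

The sector-by-sector instances (`decide`) are in the next file. No named fact is introduced.

## References

* M. Khovanov, *A categorification of the Jones polynomial*, Duke Math. J. 101 (2000) 359–426,
  §5.4. [cite: Khovanov2000, §5.4]
* D. Bar-Natan, *On Khovanov's categorification of the Jones polynomial*, Algebr. Geom. Topol. 2
  (2002) 337–370, §4.4. [cite: BarNatan2002, §4]
-/

open Function

namespace Literature.Topology.FourManifolds

namespace GaussDiagram

/-! ## The abstract local arcs and gluings -/

/-- **The nine abstract local arcs of the triangle**: the six ends and the three sides. [folklore] -/
inductive LocArc
  | inA | outA | inB | outB | inC | outC | sA | sB | sC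
  deriving DecidableEq, Fintype, Repr

namespace LocArc

/-- The sides among the abstract local arcs. [folklore] -/
def IsSide : LocArc → Prop
  | sA | sB | sC => True
  | _ => False

/-- Being a side is decidable. [folklore] -/
instance : DecidablePred IsSide := fun a ↦ by cases a <;> unfold IsSide <;> infer_instance

end LocArc

open LocArc

/-- **The local gluings of `G`** over a state with `(σ x, σ y, σ z) = (bx, by, bz)` (the tables
`glueRel_overPos_x`, … of `KhTriangle.lean`; each unordered pair listed once). [folklore] -/
def locEdgesG (bx by_ bz : Bool) : List (LocArc × LocArc) :=
  (if bx then [(.inA, .inB), (.sA, .sB)] else [(.inA, .sB), (.inB, .sA)]) ++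
    ((if by_ then [(.sA, .inC), (.outA, .sC)] else [(.sA, .sC), (.inC, .outA)]) ++
      (if bz then [(.sB, .sC), (.outB, .outC)] else [(.sB, .outC), (.sC, .outB)]))

/-- **The local gluings of the braid rearrangement** over a state with
`(σ x, σ y, σ z) = (bx, by, bz)` (the tables `glueRel_braidMove_overPos_y`, …). [folklore] -/
def locEdgesG' (bx by_ bz : Bool) : List (LocArc × LocArc) :=
  (if bx then [(.sA, .sB), (.outA, .outB)] else [(.sA, .outB), (.sB, .outA)]) ++
    ((if by_ then [(.inA, .sC), (.sA, .outC)] else [(.inA, .outC), (.sC, .sA)]) ++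
      (if bz then [(.inB, .inC), (.sB, .sC)] else [(.inB, .sC), (.inC, .sB)]))

/-- The finite graph spanned by a list of pairs of abstract local arcs. [folklore] -/
def locGraph (E : List (LocArc × LocArc)) : SimpleGraph LocArc :=
  SimpleGraph.fromRel fun a b ↦ (a, b) ∈ E

/-- Adjacency in a local graph is decidable. [folklore] -/
instance (E : List (LocArc × LocArc)) : DecidableRel (locGraph E).Adj := fun a b ↦ by
  unfold locGraph; infer_instance

/-- A listed pair is connected in the local graph. [folklore] -/
theorem locGraph_reachable_of_mem {E : List (LocArc × LocArc)} {e : LocArc × LocArc} (he : e ∈ E) :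
    (locGraph E).Reachable e.1 e.2 := by
  by_cases h : e.1 = e.2
  · rw [h]
  · exact SimpleGraph.Adj.reachable ((SimpleGraph.fromRel_adj _ _ _).2 ⟨h, Or.inl he⟩)

section Interp

variable (G : GaussDiagram) (x y z : Fin G.n)

/-- **The interpretation of the abstract local arcs** in `G` (and in `G.braidMove x y z`, which
has the same arcs). [folklore] -/
def locArc : LocArc → G.Arc
  | .inA => G.inA x
  | .outA => G.outA y
  | .inB => G.inB x
  | .outB => G.outB z
  | .inC => G.inC y
  | .outC => G.outC z
  | .sA => G.sideA x
  | .sB => G.sideB x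
  | .sC => G.sideC y

variable {x y z}
variable (hxz : x ≠ z) (ha : (G.overPos y : ℕ) = G.overPos x + 1) (hb : (G.overPos z : ℕ) = G.underPos x + 1)
  (hc : (G.underPos z : ℕ) = G.underPos y + 1) (hx : G.sign x = 1) (hy : G.sign y = 1) (hz : G.sign z = 1)

include hxz ha hb hc in
/-- The interpretation of an abstract arc is a side iff the abstract arc is. [folklore] -/
theorem inT_locArc_iff (a : LocArc) : G.InT x y (G.locArc x y z a) ↔ a.IsSide := by
  cases a
  · exact iff_of_false (G.not_inT_inA hxz ha hb hc) id
  · exact iff_of_false (G.not_inT_outA ha) id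
  · exact iff_of_false (G.not_inT_inB hxz ha hb hc) id
  · exact iff_of_false (G.not_inT_outB (y := y) hxz) id
  · exact iff_of_false (G.not_inT_inC ha hb hc) id
  · exact iff_of_false (G.not_inT_outC hxz hc) id
  · exact iff_of_true G.inT_sideA trivial
  · exact iff_of_true G.inT_sideB trivial
  · exact iff_of_true G.inT_sideC trivial

/-- A side of the triangle is the interpretation of an abstract side. [folklore] -/
theorem exists_locArc_of_inT {u : G.Arc} (hu : G.InT x y u) :
    ∃ a : LocArc, a.IsSide ∧ G.locArc x y z a = u := by
  rcases hu with rfl | rfl | rfl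
  · exact ⟨.sA, trivial, rfl⟩
  · exact ⟨.sB, trivial, rfl⟩
  · exact ⟨.sC, trivial, rfl⟩

/-- A pair of arcs is (up to order) the interpretation of an abstract pair. [folklore] -/
def IsInterp (u v : G.Arc) (e : LocArc × LocArc) : Prop :=
  (G.locArc x y z e.1 = u ∧ G.locArc x y z e.2 = v) ∨ (G.locArc x y z e.1 = v ∧ G.locArc x y z e.2 = u)

include ha hb hc hx hy hz in
/-- **Every gluing of `G` at a local passage is a listed local pair.** [folklore] -/
theorem glueRel_local (τ : G.State) {p : Fin (2 * G.n)}
    (hp : p = G.overPos x ∨ p = G.underPos x ∨ p = G.overPos y ∨ p = G.underPos y ∨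
      p = G.overPos z ∨ p = G.underPos z)
    {u v : G.Arc} (h : G.glueRel τ p u v) :
    ∃ e ∈ locEdgesG (τ x) (τ y) (τ z), G.IsInterp (x := x) (y := y) (z := z) u v e := by
  unfold IsInterp
  rcases hp with rfl | rfl | rfl | rfl | rfl | rfl
  · rw [G.glueRel_overPos_x hx] at h
    rcases h with ⟨hb', ⟨rfl, rfl⟩ | ⟨rfl, rfl⟩⟩ | ⟨hb', ⟨rfl, rfl⟩ | ⟨rfl, rfl⟩⟩
    · exact ⟨(.inA, .sB), by simp [locEdgesG, hb'], Or.inl ⟨rfl, rfl⟩⟩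
    · exact ⟨(.inA, .sB), by simp [locEdgesG, hb'], Or.inr ⟨rfl, rfl⟩⟩
    · exact ⟨(.inA, .inB), by simp [locEdgesG, hb'], Or.inl ⟨rfl, rfl⟩⟩
    · exact ⟨(.sA, .sB), by simp [locEdgesG, hb'], Or.inl ⟨rfl, rfl⟩⟩
  · rw [G.glueRel_underPos_x hx] at h
    rcases h with ⟨hb', ⟨rfl, rfl⟩ | ⟨rfl, rfl⟩⟩ | ⟨hb', ⟨rfl, rfl⟩ | ⟨rfl, rfl⟩⟩
    · exact ⟨(.inB, .sA), by simp [locEdgesG, hb'], Or.inl ⟨rfl, rfl⟩⟩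
    · exact ⟨(.inB, .sA), by simp [locEdgesG, hb'], Or.inr ⟨rfl, rfl⟩⟩
    · exact ⟨(.inA, .inB), by simp [locEdgesG, hb'], Or.inr ⟨rfl, rfl⟩⟩
    · exact ⟨(.sA, .sB), by simp [locEdgesG, hb'], Or.inr ⟨rfl, rfl⟩⟩
  · rw [G.glueRel_overPos_y ha hy] at h
    rcases h with ⟨hb', ⟨rfl, rfl⟩ | ⟨rfl, rfl⟩⟩ | ⟨hb', ⟨rfl, rfl⟩ | ⟨rfl, rfl⟩⟩
    · exact ⟨(.sA, .sC), by simp [locEdgesG, hb'], Or.inl ⟨rfl, rfl⟩⟩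
    · exact ⟨(.sA, .sC), by simp [locEdgesG, hb'], Or.inr ⟨rfl, rfl⟩⟩
    · exact ⟨(.sA, .inC), by simp [locEdgesG, hb'], Or.inl ⟨rfl, rfl⟩⟩
    · exact ⟨(.outA, .sC), by simp [locEdgesG, hb'], Or.inl ⟨rfl, rfl⟩⟩
  · rw [G.glueRel_underPos_y ha hy] at h
    rcases h with ⟨hb', ⟨rfl, rfl⟩ | ⟨rfl, rfl⟩⟩ | ⟨hb', ⟨rfl, rfl⟩ | ⟨rfl, rfl⟩⟩
    · exact ⟨(.inC, .outA), by simp [locEdgesG, hb'], Or.inl ⟨rfl, rfl⟩⟩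
    · exact ⟨(.inC, .outA), by simp [locEdgesG, hb'], Or.inr ⟨rfl, rfl⟩⟩
    · exact ⟨(.sA, .inC), by simp [locEdgesG, hb'], Or.inr ⟨rfl, rfl⟩⟩
    · exact ⟨(.outA, .sC), by simp [locEdgesG, hb'], Or.inr ⟨rfl, rfl⟩⟩
  · rw [G.glueRel_overPos_z hb hc hz] at h
    rcases h with ⟨hb', ⟨rfl, rfl⟩ | ⟨rfl, rfl⟩⟩ | ⟨hb', ⟨rfl, rfl⟩ | ⟨rfl, rfl⟩⟩
    · exact ⟨(.sB, .outC), by simp [locEdgesG, hb'], Or.inl ⟨rfl, rfl⟩⟩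
    · exact ⟨(.sB, .outC), by simp [locEdgesG, hb'], Or.inr ⟨rfl, rfl⟩⟩
    · exact ⟨(.sB, .sC), by simp [locEdgesG, hb'], Or.inl ⟨rfl, rfl⟩⟩
    · exact ⟨(.outB, .outC), by simp [locEdgesG, hb'], Or.inl ⟨rfl, rfl⟩⟩
  · rw [G.glueRel_underPos_z hb hc hz] at h
    rcases h with ⟨hb', ⟨rfl, rfl⟩ | ⟨rfl, rfl⟩⟩ | ⟨hb', ⟨rfl, rfl⟩ | ⟨rfl, rfl⟩⟩
    · exact ⟨(.sC, .outB), by simp [locEdgesG, hb'], Or.inl ⟨rfl, rfl⟩⟩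
    · exact ⟨(.sC, .outB), by simp [locEdgesG, hb'], Or.inr ⟨rfl, rfl⟩⟩
    · exact ⟨(.sB, .sC), by simp [locEdgesG, hb'], Or.inr ⟨rfl, rfl⟩⟩
    · exact ⟨(.outB, .outC), by simp [locEdgesG, hb'], Or.inr ⟨rfl, rfl⟩⟩

include hxz ha hb hc hx hy hz in
/-- **Every gluing of the braid rearrangement at a local passage is a listed local pair.**
[folklore] -/
theorem glueRel_braidMove_local (τ : G.State) {p : Fin (2 * G.n)}
    (hp : p = G.overPos x ∨ p = G.underPos x ∨ p = G.overPos y ∨ p = G.underPos y ∨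
      p = G.overPos z ∨ p = G.underPos z)
    {u v : G.Arc} (h : (G.braidMove x y z).glueRel τ p u v) :
    ∃ e ∈ locEdgesG' (τ x) (τ y) (τ z), G.IsInterp (x := x) (y := y) (z := z) u v e := by
  unfold IsInterp
  rcases hp with rfl | rfl | rfl | rfl | rfl | rfl
  · rw [G.glueRel_braidMove_overPos_x hxz hc hy] at h
    rcases h with ⟨hb', ⟨rfl, rfl⟩ | ⟨rfl, rfl⟩⟩ | ⟨hb', ⟨rfl, rfl⟩ | ⟨rfl, rfl⟩⟩
    · exact ⟨(.inA, .outC), by simp [locEdgesG', hb'], Or.inl ⟨rfl, rfl⟩⟩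
    · exact ⟨(.inA, .outC), by simp [locEdgesG', hb'], Or.inr ⟨rfl, rfl⟩⟩
    · exact ⟨(.inA, .sC), by simp [locEdgesG', hb'], Or.inl ⟨rfl, rfl⟩⟩
    · exact ⟨(.sA, .outC), by simp [locEdgesG', hb'], Or.inl ⟨rfl, rfl⟩⟩
  · rw [G.glueRel_braidMove_underPos_x ha hz] at h
    rcases h with ⟨hb', ⟨rfl, rfl⟩ | ⟨rfl, rfl⟩⟩ | ⟨hb', ⟨rfl, rfl⟩ | ⟨rfl, rfl⟩⟩
    · exact ⟨(.inB, .sC), by simp [locEdgesG', hb'], Or.inl ⟨rfl, rfl⟩⟩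
    · exact ⟨(.inB, .sC), by simp [locEdgesG', hb'], Or.inr ⟨rfl, rfl⟩⟩
    · exact ⟨(.inB, .inC), by simp [locEdgesG', hb'], Or.inl ⟨rfl, rfl⟩⟩
    · exact ⟨(.sB, .sC), by simp [locEdgesG', hb'], Or.inl ⟨rfl, rfl⟩⟩
  · rw [G.glueRel_braidMove_overPos_y hxz ha hb hc hx] at h
    rcases h with ⟨hb', ⟨rfl, rfl⟩ | ⟨rfl, rfl⟩⟩ | ⟨hb', ⟨rfl, rfl⟩ | ⟨rfl, rfl⟩⟩
    · exact ⟨(.sA, .outB), by simp [locEdgesG', hb'], Or.inl ⟨rfl, rfl⟩⟩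
    · exact ⟨(.sA, .outB), by simp [locEdgesG', hb'], Or.inr ⟨rfl, rfl⟩⟩
    · exact ⟨(.sA, .sB), by simp [locEdgesG', hb'], Or.inl ⟨rfl, rfl⟩⟩
    · exact ⟨(.outA, .outB), by simp [locEdgesG', hb'], Or.inl ⟨rfl, rfl⟩⟩
  · rw [G.glueRel_braidMove_underPos_y ha hz] at h
    rcases h with ⟨hb', ⟨rfl, rfl⟩ | ⟨rfl, rfl⟩⟩ | ⟨hb', ⟨rfl, rfl⟩ | ⟨rfl, rfl⟩⟩
    · exact ⟨(.inC, .sB), by simp [locEdgesG', hb'], Or.inl ⟨rfl, rfl⟩⟩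
    · exact ⟨(.inC, .sB), by simp [locEdgesG', hb'], Or.inr ⟨rfl, rfl⟩⟩
    · exact ⟨(.inB, .inC), by simp [locEdgesG', hb'], Or.inr ⟨rfl, rfl⟩⟩
    · exact ⟨(.sB, .sC), by simp [locEdgesG', hb'], Or.inr ⟨rfl, rfl⟩⟩
  · rw [G.glueRel_braidMove_overPos_z hxz ha hb hc hx] at h
    rcases h with ⟨hb', ⟨rfl, rfl⟩ | ⟨rfl, rfl⟩⟩ | ⟨hb', ⟨rfl, rfl⟩ | ⟨rfl, rfl⟩⟩
    · exact ⟨(.sB, .outA), by simp [locEdgesG', hb'], Or.inl ⟨rfl, rfl⟩⟩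
    · exact ⟨(.sB, .outA), by simp [locEdgesG', hb'], Or.inr ⟨rfl, rfl⟩⟩
    · exact ⟨(.sA, .sB), by simp [locEdgesG', hb'], Or.inr ⟨rfl, rfl⟩⟩
    · exact ⟨(.outA, .outB), by simp [locEdgesG', hb'], Or.inr ⟨rfl, rfl⟩⟩
  · rw [G.glueRel_braidMove_underPos_z hxz hc hy] at h
    rcases h with ⟨hb', ⟨rfl, rfl⟩ | ⟨rfl, rfl⟩⟩ | ⟨hb', ⟨rfl, rfl⟩ | ⟨rfl, rfl⟩⟩
    · exact ⟨(.sC, .sA), by simp [locEdgesG', hb'], Or.inl ⟨rfl, rfl⟩⟩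
    · exact ⟨(.sC, .sA), by simp [locEdgesG', hb'], Or.inr ⟨rfl, rfl⟩⟩
    · exact ⟨(.inA, .sC), by simp [locEdgesG', hb'], Or.inr ⟨rfl, rfl⟩⟩
    · exact ⟨(.sA, .outC), by simp [locEdgesG', hb'], Or.inr ⟨rfl, rfl⟩⟩

include ha hb hc hx hy hz in
/-- **Every listed local pair of `G` is glued in `G`.** [folklore] -/
theorem reachable_locArc_of_mem (τ : G.State) {e : LocArc × LocArc} (he : e ∈ locEdgesG (τ x) (τ y) (τ z)) :
    (G.stateGraph τ).Reachable (G.locArc x y z e.1) (G.locArc x y z e.2) := by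
  unfold locEdgesG at he
  simp only [List.mem_append] at he
  rcases he with he | he | he
  · cases hxv : τ x <;> rw [hxv] at he <;> simp only [Bool.false_eq_true, ↓reduceIte, List.mem_cons,
      List.not_mem_nil, or_false] at he <;> rcases he with rfl | rfl
    · exact G.reachable_of_glueRel τ ((G.glueRel_overPos_x hx τ _ _).2 (Or.inl ⟨hxv, Or.inl ⟨rfl, rfl⟩⟩))
    · exact G.reachable_of_glueRel τ ((G.glueRel_underPos_x hx τ _ _).2 (Or.inl ⟨hxv, Or.inl ⟨rfl, rfl⟩⟩))
    · exact G.reachable_of_glueRel τ ((G.glueRel_overPos_x hx τ _ _).2 (Or.inr ⟨hxv, Or.inl ⟨rfl, rfl⟩⟩))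
    · exact G.reachable_of_glueRel τ ((G.glueRel_overPos_x hx τ _ _).2 (Or.inr ⟨hxv, Or.inr ⟨rfl, rfl⟩⟩))
  · cases hyv : τ y <;> rw [hyv] at he <;> simp only [Bool.false_eq_true, ↓reduceIte, List.mem_cons,
      List.not_mem_nil, or_false] at he <;> rcases he with rfl | rfl
    · exact G.reachable_of_glueRel τ ((G.glueRel_overPos_y ha hy τ _ _).2 (Or.inl ⟨hyv, Or.inl ⟨rfl, rfl⟩⟩))
    · exact G.reachable_of_glueRel τ ((G.glueRel_underPos_y ha hy τ _ _).2 (Or.inl ⟨hyv, Or.inl ⟨rfl, rfl⟩⟩))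
    · exact G.reachable_of_glueRel τ ((G.glueRel_overPos_y ha hy τ _ _).2 (Or.inr ⟨hyv, Or.inl ⟨rfl, rfl⟩⟩))
    · exact G.reachable_of_glueRel τ ((G.glueRel_overPos_y ha hy τ _ _).2 (Or.inr ⟨hyv, Or.inr ⟨rfl, rfl⟩⟩))
  · cases hzv : τ z <;> rw [hzv] at he <;> simp only [Bool.false_eq_true, ↓reduceIte, List.mem_cons,
      List.not_mem_nil, or_false] at he <;> rcases he with rfl | rfl
    · exact G.reachable_of_glueRel τ ((G.glueRel_overPos_z hb hc hz τ _ _).2 (Or.inl ⟨hzv, Or.inl ⟨rfl, rfl⟩⟩))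
    · exact G.reachable_of_glueRel τ ((G.glueRel_underPos_z hb hc hz τ _ _).2 (Or.inl ⟨hzv, Or.inl ⟨rfl, rfl⟩⟩))
    · exact G.reachable_of_glueRel τ ((G.glueRel_overPos_z hb hc hz τ _ _).2 (Or.inr ⟨hzv, Or.inl ⟨rfl, rfl⟩⟩))
    · exact G.reachable_of_glueRel τ ((G.glueRel_overPos_z hb hc hz τ _ _).2 (Or.inr ⟨hzv, Or.inr ⟨rfl, rfl⟩⟩))

include hxz ha hb hc hx hy hz in
/-- **Every listed local pair of the braid rearrangement is glued in it.** [folklore] -/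
theorem reachable_braidMove_locArc_of_mem (τ : G.State) {e : LocArc × LocArc}
    (he : e ∈ locEdgesG' (τ x) (τ y) (τ z)) :
    ((G.braidMove x y z).stateGraph τ).Reachable (G.locArc x y z e.1) (G.locArc x y z e.2) := by
  unfold locEdgesG' at he
  simp only [List.mem_append] at he
  rcases he with he | he | he
  · cases hxv : τ x <;> rw [hxv] at he <;> simp only [Bool.false_eq_true, ↓reduceIte, List.mem_cons,
      List.not_mem_nil, or_false] at he <;> rcases he with rfl | rfl
    · exact (G.braidMove x y z).reachable_of_glueRel τ ((G.glueRel_braidMove_overPos_y hxz ha hb hc hx τ _ _).2 (Or.inl ⟨hxv, Or.inl ⟨rfl, rfl⟩⟩))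
    · exact (G.braidMove x y z).reachable_of_glueRel τ ((G.glueRel_braidMove_overPos_z hxz ha hb hc hx τ _ _).2 (Or.inl ⟨hxv, Or.inl ⟨rfl, rfl⟩⟩))
    · exact (G.braidMove x y z).reachable_of_glueRel τ ((G.glueRel_braidMove_overPos_y hxz ha hb hc hx τ _ _).2 (Or.inr ⟨hxv, Or.inl ⟨rfl, rfl⟩⟩))
    · exact (G.braidMove x y z).reachable_of_glueRel τ ((G.glueRel_braidMove_overPos_y hxz ha hb hc hx τ _ _).2 (Or.inr ⟨hxv, Or.inr ⟨rfl, rfl⟩⟩))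
  · cases hyv : τ y <;> rw [hyv] at he <;> simp only [Bool.false_eq_true, ↓reduceIte, List.mem_cons,
      List.not_mem_nil, or_false] at he <;> rcases he with rfl | rfl
    · exact (G.braidMove x y z).reachable_of_glueRel τ ((G.glueRel_braidMove_overPos_x hxz hc hy τ _ _).2 (Or.inl ⟨hyv, Or.inl ⟨rfl, rfl⟩⟩))
    · exact (G.braidMove x y z).reachable_of_glueRel τ ((G.glueRel_braidMove_underPos_z hxz hc hy τ _ _).2 (Or.inl ⟨hyv, Or.inl ⟨rfl, rfl⟩⟩))
    · exact (G.braidMove x y z).reachable_of_glueRel τ ((G.glueRel_braidMove_overPos_x hxz hc hy τ _ _).2 (Or.inr ⟨hyv, Or.inl ⟨rfl, rfl⟩⟩))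
    · exact (G.braidMove x y z).reachable_of_glueRel τ ((G.glueRel_braidMove_overPos_x hxz hc hy τ _ _).2 (Or.inr ⟨hyv, Or.inr ⟨rfl, rfl⟩⟩))
  · cases hzv : τ z <;> rw [hzv] at he <;> simp only [Bool.false_eq_true, ↓reduceIte, List.mem_cons,
      List.not_mem_nil, or_false] at he <;> rcases he with rfl | rfl
    · exact (G.braidMove x y z).reachable_of_glueRel τ ((G.glueRel_braidMove_underPos_x ha hz τ _ _).2 (Or.inl ⟨hzv, Or.inl ⟨rfl, rfl⟩⟩))
    · exact (G.braidMove x y z).reachable_of_glueRel τ ((G.glueRel_braidMove_underPos_y ha hz τ _ _).2 (Or.inl ⟨hzv, Or.inl ⟨rfl, rfl⟩⟩))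
    · exact (G.braidMove x y z).reachable_of_glueRel τ ((G.glueRel_braidMove_underPos_x ha hz τ _ _).2 (Or.inr ⟨hzv, Or.inl ⟨rfl, rfl⟩⟩))
    · exact (G.braidMove x y z).reachable_of_glueRel τ ((G.glueRel_braidMove_underPos_x ha hz τ _ _).2 (Or.inr ⟨hzv, Or.inr ⟨rfl, rfl⟩⟩))

end Interp


/-! ## The transfer principle -/

section Transfer

variable (G : GaussDiagram) {x y z : Fin G.n}
variable (hxz : x ≠ z) (ha : (G.overPos y : ℕ) = G.overPos x + 1) (hb : (G.overPos z : ℕ) = G.underPos x + 1)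
  (hc : (G.underPos z : ℕ) = G.underPos y + 1) (hx : G.sign x = 1) (hy : G.sign y = 1) (hz : G.sign z = 1)

/-- A gluing clause depends on the state only through the smoothing of the chord of the
position. [folklore] -/
theorem glueRel_congr_state {τ τ' : G.State} {q : Fin (2 * G.n)} (h : τ (G.chordOf q) = τ' (G.chordOf q))
    (u v : G.Arc) : G.glueRel τ q u v ↔ G.glueRel τ' q u v := by
  unfold glueRel isSeifert; rw [h]

variable (x y z) in
/-- **Retouching the sides**: replace each side of the triangle by the interpretation of its
image under a map `pl` of abstract local arcs, keep the other arcs. [folklore] -/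
noncomputable def retouch (pl : LocArc → LocArc) (u : G.Arc) : G.Arc :=
  if u = G.sideA x then G.locArc x y z (pl .sA)
  else if u = G.sideB x then G.locArc x y z (pl .sB)
  else if u = G.sideC y then G.locArc x y z (pl .sC) else u

/-- The first and third sides are distinct arcs. [folklore] -/
theorem sideA_ne_sideC : G.sideA x ≠ G.sideC y := fun h ↦
  G.overPos_ne_underPos x y (G.arcOut_injective h)

/-- Retouching does not move the arcs off the triangle. [folklore] -/
theorem retouch_of_not_inT (pl : LocArc → LocArc) {u : G.Arc} (hu : ¬ G.InT x y u) :
    G.retouch x y z pl u = u := by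
  unfold retouch
  rw [if_neg (fun h : u = G.sideA x ↦ hu (h ▸ G.inT_sideA)),
    if_neg (fun h : u = G.sideB x ↦ hu (h ▸ G.inT_sideB)),
    if_neg (fun h : u = G.sideC y ↦ hu (h ▸ G.inT_sideC))]

include hxz ha hb hc in
/-- Retouching an interpreted abstract arc interprets the abstract retouching, for a map fixing
the ends. [folklore] -/
theorem retouch_locArc (pl : LocArc → LocArc) (hpl : ∀ a, ¬ a.IsSide → pl a = a) (a : LocArc) :
    G.retouch x y z pl (G.locArc x y z a) = G.locArc x y z (pl a) := by
  by_cases hs : a.IsSide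
  · cases a <;> simp only [LocArc.IsSide] at hs
    · show G.retouch x y z pl (G.sideA x) = _
      unfold retouch; rw [if_pos rfl]
    · show G.retouch x y z pl (G.sideB x) = _
      unfold retouch; rw [if_neg (G.sideA_ne_sideB).symm, if_pos rfl]
    · show G.retouch x y z pl (G.sideC y) = _
      unfold retouch
      rw [if_neg (G.sideA_ne_sideC (y := y)).symm, if_neg (G.sideB_ne_sideC ha).symm, if_pos rfl]
  · rw [hpl a hs, G.retouch_of_not_inT]
    rwa [G.inT_locArc_iff hxz ha hb hc]

/-- The local graph of a list maps into any graph in which the listed pairs are connected.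
[folklore] -/
theorem reachable_of_locGraph_reachable {E : List (LocArc × LocArc)} {Γ : SimpleGraph G.Arc} (ι : LocArc → G.Arc)
    (h : ∀ e ∈ E, Γ.Reachable (ι e.1) (ι e.2)) {a b : LocArc} (hab : (locGraph E).Reachable a b) :
    Γ.Reachable (ι a) (ι b) := by
  refine reachable_map_of_adj ι (fun a b hadj ↦ ?_) hab
  obtain ⟨-, h' | h'⟩ := (SimpleGraph.fromRel_adj _ _ _).1 hadj
  · exact h _ h'
  · exact (h _ h').symm

include hxz ha hb hc in
/-- **The transfer principle for the triangle.** Let `Γ₁, Γ₂` be two graphs on the arcs (state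
graphs of `G` or of its braid rearrangement) and `E₁, E₂` lists of abstract local pairs such that
every edge of `Γ₁` is an edge of `Γ₂` between arcs off the triangle or a pair listed in `E₁`, and
every pair listed in `E₂` is connected in `Γ₂`. If a retouching `pl` of the abstract sides into
ends makes every pair of `E₁` connected in the local graph of `E₂` — a finite check — then
`Γ₁`-connected arcs have `Γ₂`-connected retouchings. Khovanov (2000), §5.4; Bar-Natan (2002),
§4.4 (the two sides of `Ω3` have the same state circles away from the triangle). [cite: Khovanov2000, §5.4] -/
theorem reachable_transfer {Γ₁ Γ₂ : SimpleGraph G.Arc} {E₁ E₂ : List (LocArc × LocArc)}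
    (pl : LocArc → LocArc) (hpl : ∀ a, ¬ a.IsSide → pl a = a)
    (hloc : ∀ e ∈ E₁, (locGraph E₂).Reachable (pl e.1) (pl e.2))
    (h₁ : ∀ u v, Γ₁.Adj u v → (Γ₂.Reachable u v ∧ ¬ G.InT x y u ∧ ¬ G.InT x y v) ∨
      ∃ e ∈ E₁, G.IsInterp (x := x) (y := y) (z := z) u v e)
    (h₂ : ∀ e ∈ E₂, Γ₂.Reachable (G.locArc x y z e.1) (G.locArc x y z e.2))
    {u v : G.Arc} (huv : Γ₁.Reachable u v) :
    Γ₂.Reachable (G.retouch x y z pl u) (G.retouch x y z pl v) := by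
  refine reachable_map_of_adj (G.retouch x y z pl) (fun u v hadj ↦ ?_) huv
  rcases h₁ u v hadj with ⟨hr, hu, hv⟩ | ⟨e, he, ⟨rfl, rfl⟩ | ⟨rfl, rfl⟩⟩
  · rwa [G.retouch_of_not_inT pl hu, G.retouch_of_not_inT pl hv]
  · rw [G.retouch_locArc hxz ha hb hc pl hpl, G.retouch_locArc hxz ha hb hc pl hpl]
    exact G.reachable_of_locGraph_reachable _ h₂ (hloc e he)
  · rw [G.retouch_locArc hxz ha hb hc pl hpl, G.retouch_locArc hxz ha hb hc pl hpl]
    exact (G.reachable_of_locGraph_reachable _ h₂ (hloc e he)).symm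

include ha hb hc hx hy hz in
/-- The edges of a state graph of `G`: gluings at fourth chords, or listed local pairs. [folklore] -/
theorem adj_cases_G (τ : G.State) {Γ₂ : SimpleGraph G.Arc}
    (hnl : ∀ q, G.chordOf q ≠ x → G.chordOf q ≠ y → G.chordOf q ≠ z → ∀ u v, G.glueRel τ q u v → Γ₂.Reachable u v)
    (u v : G.Arc) (h : (G.stateGraph τ).Adj u v) :
    (Γ₂.Reachable u v ∧ ¬ G.InT x y u ∧ ¬ G.InT x y v) ∨
      ∃ e ∈ locEdgesG (τ x) (τ y) (τ z), G.IsInterp (x := x) (y := y) (z := z) u v e := by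
  rw [stateGraph_adj] at h
  obtain ⟨-, q, hq⟩ := h
  rcases G.chordOf_cases x y z q with ⟨h1, h2, h3⟩ | hp
  · left
    rcases hq with hq | hq
    · exact ⟨hnl q h1 h2 h3 u v hq, G.not_inT_of_glueRel_of_ne ha hb hc τ h1 h2 h3 hq⟩
    · obtain ⟨hv, hu⟩ := G.not_inT_of_glueRel_of_ne ha hb hc τ h1 h2 h3 hq
      exact ⟨(hnl q h1 h2 h3 v u hq).symm, hu, hv⟩
  · right
    rcases hq with hq | hq
    · exact G.glueRel_local ha hb hc hx hy hz τ hp hq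
    · obtain ⟨e, he, h'⟩ := G.glueRel_local ha hb hc hx hy hz τ hp hq
      refine ⟨e, he, ?_⟩
      unfold IsInterp at h' ⊢
      tauto

include hxz ha hb hc hx hy hz in
/-- The edges of a state graph of the braid rearrangement: gluings at fourth chords, or listed
local pairs. [folklore] -/
theorem adj_cases_G' (τ : G.State) {Γ₂ : SimpleGraph G.Arc}
    (hnl : ∀ q, G.chordOf q ≠ x → G.chordOf q ≠ y → G.chordOf q ≠ z → ∀ u v, G.glueRel τ q u v → Γ₂.Reachable u v)
    (u v : G.Arc) (h : ((G.braidMove x y z).stateGraph τ).Adj u v) :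
    (Γ₂.Reachable u v ∧ ¬ G.InT x y u ∧ ¬ G.InT x y v) ∨
      ∃ e ∈ locEdgesG' (τ x) (τ y) (τ z), G.IsInterp (x := x) (y := y) (z := z) u v e := by
  rw [stateGraph_adj] at h
  obtain ⟨-, q, hq⟩ := h
  rcases G.chordOf_cases x y z q with ⟨h1, h2, h3⟩ | hp
  · left
    rw [G.glueRel_braidMove_of_ne τ h1 h2 h3, G.glueRel_braidMove_of_ne τ h1 h2 h3] at hq
    rcases hq with hq | hq
    · exact ⟨hnl q h1 h2 h3 u v hq, G.not_inT_of_glueRel_of_ne ha hb hc τ h1 h2 h3 hq⟩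
    · obtain ⟨hv, hu⟩ := G.not_inT_of_glueRel_of_ne ha hb hc τ h1 h2 h3 hq
      exact ⟨(hnl q h1 h2 h3 v u hq).symm, hu, hv⟩
  · right
    rcases hq with hq | hq
    · exact G.glueRel_braidMove_local hxz ha hb hc hx hy hz τ hp hq
    · obtain ⟨e, he, h'⟩ := G.glueRel_braidMove_local hxz ha hb hc hx hy hz τ hp hq
      refine ⟨e, he, ?_⟩
      unfold IsInterp at h' ⊢
      tauto

/-- Gluings of `G` at fourth chords are gluings of `G` in any state agreeing there. [folklore] -/
theorem hnl_G {τ τ' : G.State} (hτ : ∀ j, j ≠ x → j ≠ y → j ≠ z → τ j = τ' j) (q : Fin (2 * G.n))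
    (h1 : G.chordOf q ≠ x) (h2 : G.chordOf q ≠ y) (h3 : G.chordOf q ≠ z) (u v : G.Arc)
    (h : G.glueRel τ q u v) : (G.stateGraph τ').Reachable u v :=
  G.reachable_of_glueRel τ' ((G.glueRel_congr_state (hτ _ h1 h2 h3) u v).1 h)

/-- Gluings of `G` at fourth chords are gluings of the braid rearrangement in any state agreeing
there. [folklore] -/
theorem hnl_G' {τ τ' : G.State} (hτ : ∀ j, j ≠ x → j ≠ y → j ≠ z → τ j = τ' j) (q : Fin (2 * G.n))
    (h1 : G.chordOf q ≠ x) (h2 : G.chordOf q ≠ y) (h3 : G.chordOf q ≠ z) (u v : G.Arc)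
    (h : G.glueRel τ q u v) : ((G.braidMove x y z).stateGraph τ').Reachable u v :=
  (G.braidMove x y z).reachable_of_glueRel τ'
    ((G.glueRel_braidMove_of_ne τ' h1 h2 h3 u v).2 ((G.glueRel_congr_state (hτ _ h1 h2 h3) u v).1 h))

end Transfer

end GaussDiagram

end Literature.Topology.FourManifolds
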